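import Literature.NumberTheory.Kottwitz1992.HermitianSymmetricSpacesLemma42Holds
import HarnessLib

/-!
# [Kottwitz1992, Lemma 4.2 (second statement) p. 387] The description of `X_∞` — DISCHARGED: `Kottwitz1992_4_2_XInfty_holds`

Kernel-lane companion of the statement carpet ★ `Literature/NumberTheory/Kottwitz1992/HermitianSymmetricSpaces.lean` (squad TK, TK-t02;
builds on ★ `HermitianSymmetricSpacesLemma42Holds`, the first statement of Lemma 4.2): the named fact ★
`HermitianSymmetricSpaces.Kottwitz1992_4_2_XInfty` — «Moreover the set `X_∞` for `(B, *, V, ⟨·,·⟩, h)` is equal to the set of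
`*`-homomorphisms `h′` from `ℂ` to `C = End_B(V)` satisfying the following two conditions.  (1) The form `⟨v, h′(i)w⟩` is positive or
negative definite.  (2) The two `B ⊗_ℝ ℂ`-module structures on `V` obtained from `h` and `h′` are isomorphic» — is PROVED here as
`theorem Kottwitz1992_4_2_XInfty_holds : Kottwitz1992_4_2_XInfty`.  THEOREMS ONLY (no definition, no named fact, no `sorry`, no instance,
no notation); cell hodgecm-mathlib, seat B-typ04 (g30); net debt −1.

R. E. Kottwitz, *Points on some Shimura varieties over finite fields*, J. Amer. Math. Soc. 5 (1992), Lemma 4.2 p. 387, proof p. 388 L6–L11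
(held `paper:doi-10-2307-2152772`, p0016).  THE PRINTED PROOF: «As for the second statement, it is easy to see that any `h′ ∈ X_∞`
satisfies (1) and (2).  Conversely, if `h′` satisfies (1) and (2), it follows from the first statement of the lemma that there exists a
nonzero real number `r` and an isomorphism `g` of skew-Hermitian `B ⊗_ℝ ℂ`-modules from `(V, ⟨·,·⟩, h)` to `(V, r⟨·,·⟩, h′)`.  Concretely,
`g` is an element of `G(ℝ)` conjugating `h` into `h′`, which shows that `h′ ∈ X_∞`.»  Followed verbatim (★ `XInfty`, ★ `SkewHermitianForm`,
★ `HodgeMap`):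
* §1 (→) «easy to see»: for `h′ = Int(g) ∘ h` with `g ∈ G(ℝ)` (`⟨gv, gw⟩ = c⟨v, w⟩`, `c ∈ ℝ^×`), `g` itself is the module isomorphism of
  (2), and `⟨v, h′(i)v⟩ = c ⟨u, h(i)u⟩` for `v = g u` is definite with the sign of `c`, which is (1);
* §2 (←): with `r = ±1` the sign making `r⟨v, h′(i)v⟩ > 0` (condition (1)), `(r⟨·,·⟩, h′)` «satisfy the same conditions as `⟨·,·⟩` and
  `h`» (the data of p. 387), so the first statement (★ `Kottwitz1992_4_2_iso_holds`) applied with (2) gives `g` commuting with `ρ(B)`,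
  conjugating `h` into `h′`, with `r⟨gv, gw⟩ = ⟨v, w⟩`, i.e. `⟨gv, gw⟩ = r⟨v, w⟩` (`r² = 1`): `g ∈ G(ℝ)` and `h′ ∈ X_∞`.
HONEST LABEL: HC_CM is proved only modulo the 7 printed citations (2 remaining: hLiu418, h413) until rung 0 closes; this file adds no citation
debt (0 facts, 0 sorry) and discharges 1 named fact of ★ `HermitianSymmetricSpaces`.

## References
* [Kottwitz1992] R. E. Kottwitz, Points on some Shimura varieties over finite fields, J. Amer. Math. Soc. 5 (1992) 373–444, Lemma 4.2 and
  its proof, pp. 387–388; the data `(B, *, V, ⟨·,·⟩, h)` and the set `X_∞`, pp. 386–387.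
-/

noncomputable section

namespace Literature.NumberTheory.Kottwitz1992.HermitianSymmetricSpaces

open scoped ComplexConjugate

universe u v

/-- **Lemma 4.2 (second statement), PROVED**: ★ `Kottwitz1992_4_2_XInfty` holds — `X_∞` is the set of `*`-homomorphisms `h′ : ℂ → End_B(V)`
with (1) `⟨v, h′(i)w⟩` positive or negative definite and (2) the `B ⊗_ℝ ℂ`-structures from `h`, `h′` isomorphic: (→) is immediate from
`h′ = Int(g) ∘ h`, `⟨gv, gw⟩ = c⟨v, w⟩`; (←) is the first statement applied to `(⟨·,·⟩, h)` and `(r⟨·,·⟩, h′)` with the sign `r = ±1` of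
(1). [cite: Kottwitz1992, Lemma 4.2 (p. 387)] -/
theorem Kottwitz1992_4_2_XInfty_holds : Kottwitz1992_4_2_XInfty.{u, v} := by
  intro B _ _ _ _ _ _ V _ _ _ ρ ψ η h' hposB hcomm hadj
  constructor
  · /- §1 «it is easy to see that any `h′ ∈ X_∞` satisfies (1) and (2)» -/
    rintro ⟨g, c, hc, hgρ, hgψ, hgh⟩
    refine ⟨?_, g, hgρ, fun z x => (hgh z x).symm⟩
    -- `⟨v, h′(i) v⟩ = c ⟨u, h(i) u⟩` for `v = g u`
    have key : ∀ x : V, ψ.form x (h' Complex.I x) = c * ψ.form (g.symm x) (η.h Complex.I (g.symm x)) := fun x => by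
      conv_lhs => rw [← g.apply_symm_apply x]
      rw [hgh, hgψ]
    rcases lt_or_gt_of_ne hc with hc0 | hc0
    · right
      intro x hx
      rw [key]
      exact mul_neg_of_neg_of_pos hc0 (η.pos _ (g.symm.map_ne_zero_iff.mpr hx))
    · left
      intro x hx
      rw [key]
      exact mul_pos hc0 (η.pos _ (g.symm.map_ne_zero_iff.mpr hx))
  · /- §2 «Conversely, if `h′` satisfies (1) and (2) …» -/
    rintro ⟨hdef, f, hfρ, hfh⟩
    -- the sign `r = ±1` with `r ⟨v, h′(i) v⟩ > 0`
    obtain ⟨r, hr, hrpos⟩ : ∃ r : ℝ, r * r = 1 ∧ ∀ x : V, x ≠ 0 → 0 < r * ψ.form x (h' Complex.I x) := by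
      rcases hdef with hp | hn
      · exact ⟨1, one_mul 1, fun x hx => by rw [one_mul]; exact hp x hx⟩
      · exact ⟨-1, by norm_num, fun x hx => by rw [neg_one_mul]; exact neg_pos.mpr (hn x hx)⟩
    have hr0 : r ≠ 0 := fun h0 => by rw [h0, mul_zero] at hr; exact zero_ne_one hr
    /- «`(V, r⟨·,·⟩, h′)`»: the data of p. 387 for the form `r⟨·,·⟩` and the map `h′` -/
    let ψ' : SkewHermitianForm ρ :=
      { form := r • ψ.form
        isAlt := fun x => by rw [LinearMap.smul_apply, LinearMap.smul_apply, ψ.isAlt, smul_zero]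
        nondegenerate :=
          ⟨fun x hx => ψ.nondegenerate.1 x fun y => by
              have h0 := hx y
              rw [LinearMap.smul_apply, LinearMap.smul_apply, smul_eq_mul] at h0
              exact (mul_eq_zero.mp h0).resolve_left hr0,
            fun y hy => ψ.nondegenerate.2 y fun x => by
              have h0 := hy x
              rw [LinearMap.smul_apply, LinearMap.smul_apply, smul_eq_mul] at h0
              exact (mul_eq_zero.mp h0).resolve_left hr0⟩
        skew := fun b x y => by simp only [LinearMap.smul_apply, ψ.skew] }
    have hψ' : ∀ x y : V, ψ'.form x y = r * ψ.form x y := fun x y => rfl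
    let η' : HodgeMap ψ' :=
      { h := h'
        comm := hcomm
        adjoint := fun z x y => by rw [hψ', hψ', hadj]
        pos := fun x hx => by rw [hψ']; exact hrpos x hx }
    /- «it follows from the first statement of the lemma that there exists … an isomorphism `g` of skew-Hermitian `B ⊗_ℝ ℂ`-modules
    from `(V, ⟨·,·⟩, h)` to `(V, r⟨·,·⟩, h′)`» -/
    obtain ⟨g, hgρ, hgh, hgψ⟩ := Kottwitz1992_4_2_iso_holds B V ρ ψ ψ' η η' hposB ⟨f, hfρ, hfh⟩
    /- «Concretely, `g` is an element of `G(ℝ)` conjugating `h` into `h′`, which shows that `h′ ∈ X_∞`.» -/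
    refine ⟨g, r, hr0, hgρ, fun x y => ?_, fun z x => (hgh z x).symm⟩
    have h0 := hgψ x y
    rw [hψ'] at h0
    calc ψ.form (g x) (g y) = r * r * ψ.form (g x) (g y) := by rw [hr, one_mul]
      _ = r * ψ.form x y := by rw [mul_assoc, h0]

end Literature.NumberTheory.Kottwitz1992.HermitianSymmetricSpaces

end
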